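import Literature.NumberTheory.ModularForms.LevelOneEisensteinCongruenceCuspForm
import Literature.NumberTheory.ModularForms.LevelOneWeightTwentyFourEigenforms
import Literature.NumberTheory.LFunctions.Hinkkanen1997.BernoulliTable
import Mathlib.NumberTheory.Zsqrtd.Basic
import HarnessLib

/-!
# The Ramanujan-type congruences in weight `24`: `N₂₄ = 103 · 2294797` and the eigenforms of `S₂₄(SL₂(ℤ))`
# (Datskovsky–Guerzhoy, the example after Thm. 2)

B. Datskovsky, P. Guerzhoy, *On Ramanujan congruences for modular forms of integral and half-integral weights*,
Proc. Amer. Math. Soc. **124** (1996), p. 2286–2287, verbatim: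

> "When `dim S_k` is low, and in particular when `dim S_k = 2`, Theorem 2 has an "elementary" arithmetic flavor. As an
> illustration of this flavor we are now going to consider in more detail the weight `k = 24`. In this case
> `dim S₂₄ = 2`, and `S₂₄` is generated over the field of complex numbers `ℂ` by two cusp forms `Δ²` and `ΔG₁₂`.
> Calculations show that `K = ℚ(√144169)` and the two primitive forms are
> `u = (324204/691 − 12√144169)Δ² + (65520/691)ΔG₁₂`, `v = (324204/691 + 12√144169)Δ² + (65520/691)ΔG₁₂`. The prime
> divisors of the numerator of `B₂₄/48` are `103` and `2294797`. They both split in `K`: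
> `103 = (103, 22 + √144169)(103, 22 − √144169)`,
> `2294797 = (2294797, 1022092 + √144169)(2294797, 1022092 − √144169)`. One can check that in accordance with
> Theorem 2 `u ≡ G₂₄ mod (2294797, 1022092 − √144169)(103, 22 + √144169)` and
> `v ≡ G₂₄ mod (2294797, 1022092 + √144169)(103, 22 − √144169)`.
> One can also rewrite these congruences in elementary way, i.e. using only arithmetic functions `τ(n)` and
> `σ_k(n)` … `≡ σ₂₃(n) mod 103`, … `≡ σ₂₃(n) mod 2294797`."

In the tree's coordinates (Zagier, *1-2-3* §4.1; file `LevelOneWeightTwentyFourEigenforms`): `ΔG₁₂ = (691/65520)ΔE₁₂`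
and `ΔE₁₂ = ΔE₄³ − (432000/691)Δ²`, so `u = ΔE₄³ − (156 + 12√144169)Δ² = f₂` and `v = f₁`. Everything below is PROVED:

* `B₂₄/48 = −236364091/131040` in lowest terms (the tree's `bernoulli'_24`), `N₂₄ = 236364091 = 103 · 2294797` with
  both factors prime;
* the **elementary master congruence** `[qⁿ](ΔE₄³ + 8387913·Δ²) ≡ σ₂₃(n) (mod 236364091)` for all `n ≥ 1` (from
  Theorem 1's integral cusp form `g = a₁(g)·ΔE₄³ + (a₂(g) − 696a₁(g))·Δ²` with `a_n(g) ≡ 131040·σ₂₃(n)`, and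
  `(131040, N₂₄) = 1`; note `8387913 = σ₂₃(2) − 696`), hence `[qⁿ](ΔE₄³ + 5Δ²) ≡ σ₂₃(n) (mod 103)` and
  `[qⁿ](ΔE₄³ + 1503522·Δ²) ≡ σ₂₃(n) (mod 2294797)`;
* the eigenform reading, as printed: with `a_n(f₁,₂) = x_n ± 12 y_n √144169 ∈ ℤ[√144169]` (`x_n = [qⁿ](ΔE₄³ − 156Δ²)`,
  `y_n = [qⁿ]Δ²`), the reduction `ℤ[√144169] → 𝔽₁₀₃`, `√144169 ↦ −22` (kernel `∋ 103, 22 + √144169`) sends `a_n(f₂)`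
  to `σ₂₃(n)` for all `n ≥ 1` — `u = f₂ ≡ G₂₄ mod (103, 22 + √144169)` — and `√144169 ↦ 22` does the same for `f₁`
  (`v`); likewise `√144169 ↦ ∓1022092` modulo `2294797`; and `f₁ ≢ G₂₄ mod (103, 22 + √144169)` (exactly one of the
  two eigenforms per prime, as Theorem 2 predicts).

## References

* [DatskovskyGuerzhoy1996] B. Datskovsky, P. Guerzhoy, Proc. AMS 124 (1996), the example `k = 24` (p. 2286–2287).
* [Zagier2008] D. Zagier, in *The 1-2-3 of Modular Forms*, §4.1 (Hecke's example `k = 24`, `f₁, f₂`, `ℚ(√144169)`).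
-/

noncomputable section

open scoped MatrixGroups ModularForm
open UpperHalfPlane hiding I
open ArithmeticFunction (sigma sigma_one)

namespace Literature.NumberTheory.ModularForms

namespace WeightTwentyFour

/-! ## §1 `B₂₄/48 = −236364091/131040`, `N₂₄ = 103 · 2294797` -/

/-- `B₂₄/48 = −236364091/131040`. [cite: DatskovskyGuerzhoy1996, example `k = 24` ("the numerator of `B₂₄/48`")] -/
theorem bernoulliRatio_twentyFour : bernoulliRatio 24 = ((-236364091 : ℤ) : ℚ) / ((131040 : ℤ) : ℚ) := by
  rw [bernoulliRatio, bernoulli_eq_bernoulli'_of_ne_one (by norm_num),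
    Literature.NumberTheory.LFunctions.Hinkkanen1997.bernoulli'_24]
  push_cast
  norm_num

/-- ★ **`N₂₄ = 236364091`** (the numerator of `B₂₄/48` in lowest terms). [cite: DatskovskyGuerzhoy1996, example
`k = 24`] -/
theorem eisensteinNumerator_twentyFour : eisensteinNumerator 24 = 236364091 := by
  rw [eisensteinNumerator, bernoulliRatio_twentyFour, Rat.num_div_eq_of_coprime (by norm_num) (by decide)]
  rfl

/-- `D₂₄ = 131040`. [cite: DatskovskyGuerzhoy1996, example `k = 24`] -/
theorem eisensteinDenominator_twentyFour : eisensteinDenominator 24 = 131040 := by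
  rw [eisensteinDenominator, bernoulliRatio_twentyFour]
  exact_mod_cast Rat.den_div_eq_of_coprime (a := -236364091) (b := 131040) (by norm_num) (by decide)

/-- ★ **"The prime divisors of the numerator of `B₂₄/48` are `103` and `2294797`"**: `N₂₄ = 103 · 2294797`, both
prime. [cite: DatskovskyGuerzhoy1996, example `k = 24`] -/
theorem eisensteinNumerator_twentyFour_eq_mul :
    eisensteinNumerator 24 = 103 * 2294797 ∧ Nat.Prime 103 ∧ Nat.Prime 2294797 := by
  refine ⟨by rw [eisensteinNumerator_twentyFour], by norm_num, by norm_num⟩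

/-- `σ₂₃(2) = 2²³ + 1 = 8388609`. [cite: DatskovskyGuerzhoy1996, example `k = 24`] -/
theorem sigma_twentyThree_two : sigma 23 2 = 8388609 := by
  rw [sigma_prime 23 Nat.prime_two]
  norm_num

/-! ## §2 The integer coefficients of `ΔE₄³` and `Δ²` -/

/-- `c_n = [qⁿ](ΔE₄³) ∈ ℤ`. [cite: Zagier2008, §4.1 ("`ΔE₄³ = q + 696q² + ⋯`")] -/
def c (n : ℕ) : ℤ := (exists_int_coeff_G n).1.choose

/-- `d_n = [qⁿ](Δ²) ∈ ℤ`. [cite: Zagier2008, §4.1 ("`Δ² = q² − 48q³ + …`")] -/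
def d (n : ℕ) : ℤ := (exists_int_coeff_G n).2.choose

/-- `(c_n : ℂ) = [qⁿ]ΔE₄³`. [cite: Zagier2008, §4.1] -/
theorem c_spec (n : ℕ) : (c n : ℂ) = (qExpansion 1 G₁).coeff n := (exists_int_coeff_G n).1.choose_spec

/-- `(d_n : ℂ) = [qⁿ]Δ²`. [cite: Zagier2008, §4.1] -/
theorem d_spec (n : ℕ) : (d n : ℂ) = (qExpansion 1 G₂).coeff n := (exists_int_coeff_G n).2.choose_spec

/-- `c₁ = 1, c₂ = 696, d₁ = 0, d₂ = 1`. [cite: Zagier2008, §4.1] -/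
theorem c_d_values : c 1 = 1 ∧ c 2 = 696 ∧ d 1 = 0 ∧ d 2 = 1 := by
  obtain ⟨-, a1, a2, -⟩ := coeff_G₁
  obtain ⟨-, b1, b2, -⟩ := coeff_G₂
  refine ⟨?_, ?_, ?_, ?_⟩
  · have h := c_spec 1; rw [a1] at h; exact_mod_cast h
  · have h := c_spec 2; rw [a2] at h; exact_mod_cast h
  · have h := d_spec 1; rw [b1] at h; exact_mod_cast h
  · have h := d_spec 2; rw [b2] at h; exact_mod_cast h

/-- The `n`-th coefficient of `x·ΔE₄³ + y·Δ²`. [cite: Zagier2008, §4.1] -/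
theorem coeff_smul_g₁_add_smul_g₂_apply (x y : ℂ) (n : ℕ) :
    (qExpansion 1 ⇑(x • g₁ + y • g₂)).coeff n = x * (qExpansion 1 G₁).coeff n + y * (qExpansion 1 G₂).coeff n := by
  rw [CuspForm.coe_add, ModularForm.qExpansion_add one_pos one_mem_strictPeriods_SL, map_add,
    CuspForm.IsGLPos.coe_smul, ModularForm.qExpansion_smul one_pos one_mem_strictPeriods_SL,
    CuspForm.IsGLPos.coe_smul, ModularForm.qExpansion_smul one_pos one_mem_strictPeriods_SL, map_smul, map_smul,
    smul_eq_mul, smul_eq_mul, qExpansion_g₁, qExpansion_g₂]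

/-! ## §3 The master congruence modulo `N₂₄ = 236364091` -/

/-- ★ **`[qⁿ](ΔE₄³ + 8387913·Δ²) ≡ σ₂₃(n) (mod 236364091)` for every `n ≥ 1`** (`8387913 = σ₂₃(2) − 696`): the
"elementary" form of the weight-`24` Ramanujan congruences modulo the full numerator `N₂₄` — Theorem 1's integral cusp
form is `g = a₁(g)ΔE₄³ + (a₂(g) − 696a₁(g))Δ²` with `a_n(g) ≡ D₂₄σ₂₃(n) (mod N₂₄)` and `(D₂₄, N₂₄) = 1`.
[cite: DatskovskyGuerzhoy1996, Thm. 1 and example `k = 24` ("rewrite these congruences in elementary way")] -/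
theorem dvd_c_add_mul_d_sub_sigma {n : ℕ} (hn : 0 < n) :
    (236364091 : ℤ) ∣ c n + 8387913 * d n - sigma 23 n := by
  obtain ⟨g, -, hgcoeff, -⟩ := exists_integral_cuspForm_congr_eisensteinG (k := 24) (by norm_num) ⟨12, rfl⟩
  rw [eisensteinNumerator_twentyFour, eisensteinDenominator_twentyFour] at hgcoeff
  obtain ⟨m₁, hm₁, hd₁⟩ := hgcoeff 1 one_pos
  obtain ⟨m₂, hm₂, hd₂⟩ := hgcoeff 2 two_pos
  obtain ⟨m, hm, hd⟩ := hgcoeff n hn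
  -- `g = a₁(g)·g₁ + (a₂(g) − 696a₁(g))·g₂`, so `a_n(g) = m₁ c_n + (m₂ − 696 m₁) d_n`
  have hg := eq_smul_g₁_add_smul_g₂ g
  have hmn : m = m₁ * c n + (m₂ - 696 * m₁) * d n := by
    have h := congrArg (fun F : CuspForm 𝒮ℒ 24 => (qExpansion 1 ⇑F).coeff n) hg
    rw [coeff_smul_g₁_add_smul_g₂_apply, ← hm₁, ← hm₂, ← hm, ← c_spec, ← d_spec] at h
    exact_mod_cast h
  rw [show (24 : ℕ) - 1 = 23 from rfl, sigma_one] at hd₁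
  rw [show (24 : ℕ) - 1 = 23 from rfl, sigma_twentyThree_two] at hd₂
  rw [show (24 : ℕ) - 1 = 23 from rfl, hmn] at hd
  push_cast at hd₁ hd₂ hd
  -- `N ∣ 131040·(c_n + 8387913 d_n − σ₂₃(n))`, and `(131040, N) = 1`
  have h1 : (236364091 : ℤ) ∣ 131040 * (c n + 8387913 * d n - sigma 23 n) := by
    have e1 := Dvd.dvd.mul_right hd₁ (c n - 696 * d n)
    have e2 := Dvd.dvd.mul_right hd₂ (d n)
    have := Int.dvd_sub (Int.dvd_sub hd e1) e2
    have hring : m₁ * c n + (m₂ - 696 * m₁) * d n - 131040 * (sigma 23 n : ℤ) - (m₁ - 131040) * (c n - 696 * d n) -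
        (m₂ - 1099243323360) * d n = 131040 * (c n + 8387913 * d n - sigma 23 n) := by ring
    rwa [hring] at this
  exact Int.dvd_of_dvd_mul_right_of_gcd_one h1 (by norm_num)

/-- ★ **`[qⁿ](ΔE₄³ + 5Δ²) ≡ σ₂₃(n) (mod 103)`** (`8387913 ≡ 5`). [cite: DatskovskyGuerzhoy1996, example `k = 24`
("`… ≡ σ₂₃(n) mod 103`")] -/
theorem dvd_c_add_five_mul_d_sub_sigma {n : ℕ} (hn : 0 < n) : (103 : ℤ) ∣ c n + 5 * d n - sigma 23 n := by
  have h := (show (103 : ℤ) ∣ 236364091 by norm_num).trans (dvd_c_add_mul_d_sub_sigma hn)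
  have h2 : (103 : ℤ) ∣ 8387908 * d n := Dvd.dvd.mul_right (by norm_num) _
  have := Int.dvd_sub h h2
  rwa [show c n + 8387913 * d n - (sigma 23 n : ℤ) - 8387908 * d n = c n + 5 * d n - sigma 23 n by ring] at this

/-- ★ **`[qⁿ](ΔE₄³ + 1503522·Δ²) ≡ σ₂₃(n) (mod 2294797)`** (`8387913 ≡ 1503522`). [cite: DatskovskyGuerzhoy1996,
example `k = 24` ("`… ≡ σ₂₃(n) mod 2294797`")] -/
theorem dvd_c_add_mul_d_sub_sigma' {n : ℕ} (hn : 0 < n) : (2294797 : ℤ) ∣ c n + 1503522 * d n - sigma 23 n := by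
  have h := (show (2294797 : ℤ) ∣ 236364091 by norm_num).trans (dvd_c_add_mul_d_sub_sigma hn)
  have h2 : (2294797 : ℤ) ∣ 6884391 * d n := Dvd.dvd.mul_right (by norm_num) _
  have := Int.dvd_sub h h2
  rwa [show c n + 8387913 * d n - (sigma 23 n : ℤ) - 6884391 * d n = c n + 1503522 * d n - sigma 23 n by ring] at this

/-! ## §4 The eigenforms: `a_n(f₁,₂) ∈ ℤ[√144169]` and their reductions -/

/-- `√144169 · √144169 = 144169` in the form `Zsqrtd.lift` wants. [cite: Zagier2008, §4.1] -/
theorem sqrtD_mul_self : sqrtD * sqrtD = ((144169 : ℤ) : ℂ) := by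
  rw [← sq, sqrtD_sq]; norm_num

/-- The embedding `ℤ[√144169] → ℂ`, `√144169 ↦ √144169`. [cite: Zagier2008, §4.1 (`ℚ(√144169)`)] -/
def evalC : ℤ√(144169 : ℤ) →+* ℂ := Zsqrtd.lift ⟨sqrtD, sqrtD_mul_self⟩

/-- `a_n(f₁) = (c_n − 156 d_n) + 12 d_n √144169` as an element of `ℤ[√144169]`. [cite: Zagier2008, §4.1
("`f₁ = ΔE₄³ − (156 − 12√144169)Δ²`")] [cite: DatskovskyGuerzhoy1996, example `k = 24` (`v`)] -/
def coeffZ₁ (n : ℕ) : ℤ√(144169 : ℤ) := ⟨c n - 156 * d n, 12 * d n⟩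

/-- `a_n(f₂) = (c_n − 156 d_n) − 12 d_n √144169` as an element of `ℤ[√144169]`. [cite: Zagier2008, §4.1
("`f₂ = ΔE₄³ − (156 + 12√144169)Δ²`")] [cite: DatskovskyGuerzhoy1996, example `k = 24` (`u`)] -/
def coeffZ₂ (n : ℕ) : ℤ√(144169 : ℤ) := ⟨c n - 156 * d n, -12 * d n⟩

/-- `evalC (coeffZ₁ n) = a_n(f₁)`. [cite: Zagier2008, §4.1] -/
theorem evalC_coeffZ₁ (n : ℕ) : evalC (coeffZ₁ n) = (qExpansion 1 ⇑f₁).coeff n := by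
  rw [evalC, Zsqrtd.lift_apply_apply, coeffZ₁, f₁,
    show (g₁ : CuspForm 𝒮ℒ 24) + (-156 + 12 * sqrtD) • g₂ = (1 : ℂ) • g₁ + (-156 + 12 * sqrtD) • g₂ by rw [one_smul],
    coeff_smul_g₁_add_smul_g₂_apply, ← c_spec, ← d_spec]
  push_cast
  ring

/-- `evalC (coeffZ₂ n) = a_n(f₂)`. [cite: Zagier2008, §4.1] -/
theorem evalC_coeffZ₂ (n : ℕ) : evalC (coeffZ₂ n) = (qExpansion 1 ⇑f₂).coeff n := by
  rw [evalC, Zsqrtd.lift_apply_apply, coeffZ₂, f₂,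
    show (g₁ : CuspForm 𝒮ℒ 24) + (-156 - 12 * sqrtD) • g₂ = (1 : ℂ) • g₁ + (-156 - 12 * sqrtD) • g₂ by rw [one_smul],
    coeff_smul_g₁_add_smul_g₂_apply, ← c_spec, ← d_spec]
  push_cast
  ring

/-- `evalC` is injective (`144169` is not a square — indeed prime). [cite: Zagier2008, §4.1 (`√144169 ∉ ℚ`)] -/
theorem evalC_injective : Function.Injective evalC := by
  refine Zsqrtd.lift_injective _ fun n hn => ?_
  have h : Irrational (Real.sqrt 144169) := irrational_sqrt_D
  apply h
  refine ⟨|n|, ?_⟩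
  have hn' : ((144169 : ℕ) : ℝ) = ((n : ℝ)) ^ 2 := by rw [sq]; exact_mod_cast hn
  rw [show (144169 : ℝ) = ((144169 : ℕ) : ℝ) by norm_num, hn', Real.sqrt_sq_eq_abs]
  push_cast
  rfl

/-- **The reduction `ℤ[√144169] → 𝔽₁₀₃`, `√144169 ↦ −22`** (well defined: `(−22)² = 484 ≡ 144169 (mod 103)`); its
kernel contains `103` and `22 + √144169`, i.e. it is the reduction modulo the prime `(103, 22 + √144169)`.
[cite: DatskovskyGuerzhoy1996, example `k = 24` ("`103 = (103, 22 + √144169)(103, 22 − √144169)`")] -/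
def red₁₀₃ : ℤ√(144169 : ℤ) →+* ZMod 103 := Zsqrtd.lift ⟨-22, by decide⟩

/-- The conjugate reduction `√144169 ↦ 22`, modulo `(103, 22 − √144169)`. [cite: DatskovskyGuerzhoy1996, example `k = 24`] -/
def red₁₀₃' : ℤ√(144169 : ℤ) →+* ZMod 103 := Zsqrtd.lift ⟨22, by decide⟩

/-- **The reduction `ℤ[√144169] → 𝔽₂₂₉₄₇₉₇`, `√144169 ↦ 1022092`**, modulo `(2294797, 1022092 − √144169)`.
[cite: DatskovskyGuerzhoy1996, example `k = 24` ("`2294797 = (2294797, 1022092 + √144169)(2294797, 1022092 − √144169)`")] -/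
def red₂₂₉₄₇₉₇ : ℤ√(144169 : ℤ) →+* ZMod 2294797 := Zsqrtd.lift ⟨1022092, by decide⟩

/-- The conjugate reduction `√144169 ↦ −1022092`, modulo `(2294797, 1022092 + √144169)`.
[cite: DatskovskyGuerzhoy1996, example `k = 24`] -/
def red₂₂₉₄₇₉₇' : ℤ√(144169 : ℤ) →+* ZMod 2294797 := Zsqrtd.lift ⟨-1022092, by decide⟩

/-- `103` and `22 + √144169` lie in the kernel of `red₁₀₃`. [cite: DatskovskyGuerzhoy1996, example `k = 24`] -/
theorem span_le_ker_red₁₀₃ :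
    Ideal.span {(103 : ℤ√(144169 : ℤ)), ⟨22, 1⟩} ≤ RingHom.ker red₁₀₃ := by
  rw [Ideal.span_le]
  rintro x (rfl | rfl)
  · rw [SetLike.mem_coe, RingHom.mem_ker, map_ofNat]; decide
  · rw [SetLike.mem_coe, RingHom.mem_ker, red₁₀₃, Zsqrtd.lift_apply_apply]; push_cast; decide

/-- `2294797` and `1022092 − √144169` lie in the kernel of `red₂₂₉₄₇₉₇`. [cite: DatskovskyGuerzhoy1996, example `k = 24`] -/
theorem span_le_ker_red₂₂₉₄₇₉₇ :
    Ideal.span {(2294797 : ℤ√(144169 : ℤ)), ⟨1022092, -1⟩} ≤ RingHom.ker red₂₂₉₄₇₉₇ := by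
  rw [Ideal.span_le]
  rintro x (rfl | rfl)
  · rw [SetLike.mem_coe, RingHom.mem_ker, map_ofNat]; decide
  · rw [SetLike.mem_coe, RingHom.mem_ker, red₂₂₉₄₇₉₇, Zsqrtd.lift_apply_apply]; push_cast; decide

/-- ★ **`u = f₂ ≡ G₂₄ mod (103, 22 + √144169)`**: for every `n ≥ 1`, `a_n(f₂) ↦ σ₂₃(n)` under `√144169 ↦ −22`
(`(c_n − 156d_n) + 264 d_n ≡ c_n + 5d_n ≡ σ₂₃(n)`). [cite: DatskovskyGuerzhoy1996, example `k = 24`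
("`u ≡ G₂₄ mod (2294797, 1022092 − √144169)(103, 22 + √144169)`")] -/
theorem red₁₀₃_coeffZ₂ {n : ℕ} (hn : 0 < n) : red₁₀₃ (coeffZ₂ n) = (sigma 23 n : ZMod 103) := by
  obtain ⟨t, ht⟩ := dvd_c_add_five_mul_d_sub_sigma hn
  have hσ : ((sigma 23 n : ℕ) : ℤ) = c n + 5 * d n - 103 * t := by linarith
  rw [red₁₀₃, Zsqrtd.lift_apply_apply, coeffZ₂, ← Int.cast_natCast, hσ]
  push_cast
  have h103 : (103 : ZMod 103) = 0 := by decide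
  linear_combination ((d n : ZMod 103) + (t : ZMod 103)) * h103

/-- ★ **`v = f₁ ≡ G₂₄ mod (103, 22 − √144169)`** (`√144169 ↦ 22`). [cite: DatskovskyGuerzhoy1996, example `k = 24`] -/
theorem red₁₀₃'_coeffZ₁ {n : ℕ} (hn : 0 < n) : red₁₀₃' (coeffZ₁ n) = (sigma 23 n : ZMod 103) := by
  obtain ⟨t, ht⟩ := dvd_c_add_five_mul_d_sub_sigma hn
  have hσ : ((sigma 23 n : ℕ) : ℤ) = c n + 5 * d n - 103 * t := by linarith
  rw [red₁₀₃', Zsqrtd.lift_apply_apply, coeffZ₁, ← Int.cast_natCast, hσ]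
  push_cast
  have h103 : (103 : ZMod 103) = 0 := by decide
  linear_combination ((d n : ZMod 103) + (t : ZMod 103)) * h103

/-- ★ **`u = f₂ ≡ G₂₄ mod (2294797, 1022092 − √144169)`** (`√144169 ↦ 1022092`).
[cite: DatskovskyGuerzhoy1996, example `k = 24`] -/
theorem red₂₂₉₄₇₉₇_coeffZ₂ {n : ℕ} (hn : 0 < n) : red₂₂₉₄₇₉₇ (coeffZ₂ n) = (sigma 23 n : ZMod 2294797) := by
  obtain ⟨t, ht⟩ := dvd_c_add_mul_d_sub_sigma' hn
  have hσ : ((sigma 23 n : ℕ) : ℤ) = c n + 1503522 * d n - 2294797 * t := by linarith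
  rw [red₂₂₉₄₇₉₇, Zsqrtd.lift_apply_apply, coeffZ₂, ← Int.cast_natCast, hσ]
  push_cast
  have hN : (2294797 : ZMod 2294797) = 0 := by decide
  linear_combination ((t : ZMod 2294797) - 6 * (d n : ZMod 2294797)) * hN

/-- ★ **`v = f₁ ≡ G₂₄ mod (2294797, 1022092 + √144169)`** (`√144169 ↦ −1022092`).
[cite: DatskovskyGuerzhoy1996, example `k = 24`] -/
theorem red₂₂₉₄₇₉₇'_coeffZ₁ {n : ℕ} (hn : 0 < n) : red₂₂₉₄₇₉₇' (coeffZ₁ n) = (sigma 23 n : ZMod 2294797) := by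
  obtain ⟨t, ht⟩ := dvd_c_add_mul_d_sub_sigma' hn
  have hσ : ((sigma 23 n : ℕ) : ℤ) = c n + 1503522 * d n - 2294797 * t := by linarith
  rw [red₂₂₉₄₇₉₇', Zsqrtd.lift_apply_apply, coeffZ₁, ← Int.cast_natCast, hσ]
  push_cast
  have hN : (2294797 : ZMod 2294797) = 0 := by decide
  linear_combination ((t : ZMod 2294797) - 6 * (d n : ZMod 2294797)) * hN

/-- **Exactly one of the two eigenforms per prime**: `f₁ ≢ G₂₄ mod (103, 22 + √144169)` (already `a₂(f₁) ↦ 70 ≠ 83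
= σ₂₃(2) mod 103`). [cite: DatskovskyGuerzhoy1996, Thm. 2 and example `k = 24`] -/
theorem red₁₀₃_coeffZ₁_two_ne : red₁₀₃ (coeffZ₁ 2) ≠ (sigma 23 2 : ZMod 103) := by
  obtain ⟨-, c2, -, d2⟩ := c_d_values
  rw [red₁₀₃, Zsqrtd.lift_apply_apply, coeffZ₁, c2, d2, sigma_twentyThree_two]
  push_cast
  decide

end WeightTwentyFour

end Literature.NumberTheory.ModularForms
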